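import Summits.BirchSwinnertonDyer.Rank1Residual.X11b.Three.GoodReductionSubgroupFormalInputs
import Summits.BirchSwinnertonDyer.Rank1Residual.X11b.Three.GoodReductionSubgroupAdditiveHilbert90
import Summits.BirchSwinnertonDyer.Rank1Residual.X11b.Three.GoodReductionSubgroupNodeH1
import HarnessLib

/-!
# X11b at `p = 3` (team N8/O2), JET3-KUMMER (α), the formal-group half DISCHARGED over a complete
# unramified layer, and (α) PROVED at multiplicative places with a presented node

HONEST FRAMING (cell `b2b-bsdres`, run/shared/lean/b2b/bsd-rank1-residual/, verbatim in every
file): the goal of the cell is to DELETE the COMBINATION-SHAPED residual classes of the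
Birch–Swinnerton-Dyer formula for ALL analytic-rank `≤ 1` elliptic curves over `ℚ` — "full BSD
formula for every rank `≤ 1` curve in class `C`" assembled STRICTLY from published theorems — so
that the rank-`≤ 1` remainder becomes exactly the CONSTRUCTION-SHAPED classes, which are TYPED
(missing-input `Prop`s), NOT attempted. This is not "finishing BSD". Team N8/O2 = `x11b3`, seat
`b2b-bsdres-x11b3-p4`, LEAD DEAL #6 row R6-9 / A6.2 (S15 (i)), part 8 (assembly of parts 5–7).
THEOREMS ONLY: no definition, no named fact, no `sorry`; nothing is booked; the flag `JET@p|N` is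
NOT discharged (that needs p1's inputs (a), (b) and the link (c), and Jetchev §§5–7 without
`p ∤ N`); what this file removes is the hypothesis (α) of `JetchevKummerAtP` at the places in scope.

## What

In p1's dictionary (`X / F`, `L ⊇ F`, abstract discrete valuation ring `R`, `Frac R = L`,
`Gal = L ≃ₐ[F] L`, `E₀(L) = goodReductionSubgroup R (X ⊗ L)`), with a rank-one valuation
`w : Valuation L ℝ≥0` whose ring is `R` (`hw`), `R` complete (`IsAdicComplete 𝔪 R`), `k = R/𝔪`
finite of order `qⁿ`, `φ ∈ Gal` an isometry inducing `x ↦ x^q` on `k`, all of `Gal` preserving `R`,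
and a uniformiser `ϖ` of `R` coming from `F` (UNRAMIFIED: `ι ϖ = π ∈ F`):

* `exists_val_frob_sub_sub_lt_one` — input (ii) of the tree's successive approximation
  (graded additive Hilbert 90 on `𝒪_L`), from part 7 on the residue field;
* **`h1ker_of_complete`** — the formal-group stub `h1ker` of `hα_of_cyclic_of_halves` HOLDS on
  `E₁(L)` (the points reducing to `O`) for `X ⊗ L` elliptic: every `m ∈ E₁(L)` with
  `Σ_{j<n} φʲ m = O` is `φ P − P` with `P ∈ E₁(L)` — the tree's
  `FormalGroupChart.exists_map_sub_eq_of_sum_eq_zero` (Milne *ADT* I.3.8, proof: the identity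
  component / Serre *Local Fields* V §2, XIII §1) on the layer `⊤ = L` with inputs (i), (iii), (iv)
  of part 6 and (ii) above;
* **`hα_of_node_of_complete`** — hence p1's hypothesis (α) of `JetchevKummerAtP` is a THEOREM at a
  place whose reduction is a node presented over `k` (part 5 `h1red_of_node` + `h1ker_of_complete`):
  no stub remains there; `exists_baseChange_eq_add_pow_smul_of_node_of_complete` — the end form
  `T ∈ E₀(K_v) + p^m E(K_v)` (Jetchev Prop. 4.1 at `v`) modulo p1's inputs (a), (b) and the cocycle
  ONLY.

Scope (stated, not hidden): multiplicative places with the node presented over `k` (split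
multiplicative reduction over `K_v`; non-split with `[k : k_v]` even); the instantiation facts
(`#k = qⁿ`, Frobenius, isometry, uniformiser from `K_v`, completeness) are the standard properties
of the unramified extension `L_w / ℚ₃` and are hypotheses here.

References (locators only; no new fact): [cite: MilneADT2006, Ch. I Prop. 3.8 (proof)]
[cite: SilvermanAEC2009, VII.2 Prop. 2.1, Prop. VII.2.2, Exercise 3.5(a)]
[cite: SerreLocalFields1979, V §2, X §1, XIII §1] [cite: Jetchev2008, Prop. 4.1 (p. 819)]
[cite: GrossLMS1991, Prop. 6.2 (1), pp. 244–245].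

## Design

No definitions; `noncomputable section`; `open scoped Classical NNReal`. Axioms: `propext`,
`Classical.choice`, `Quot.sound`.
-/

noncomputable section

open scoped Classical NNReal

namespace Summit.BirchSwinnertonDyer.Rank1Residual.X11b.Three.JetchevKummer

open WeierstrassCurve Literature.NumberTheory.EllipticCurves
  Literature.NumberTheory.EllipticCurves.FormalGroupChart

universe u

variable {F : Type u} [Field F] (X : WeierstrassCurve F) (L : Type u) [Field L] [Algebra F L]
  (R : Type*) [CommRing R] [IsDomain R] [IsDiscreteValuationRing R] [Algebra R L]
  [IsFractionRing R L] (w : Valuation L ℝ≥0) (hw : w.Integers R)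

/-! ### §1 Input (ii): graded additive Hilbert 90 on `𝒪_L` -/

/-- Powers of `φ` as an algebra endomorphism agree with its powers as an automorphism.
[folklore] -/
theorem algHom_pow_apply (φ : L ≃ₐ[F] L) (j : ℕ) (y : L) :
    ((φ : L →ₐ[F] L) ^ j) y = (φ ^ j) y := by
  induction j generalizing y with
  | zero => simp
  | succ j ih => rw [pow_succ, pow_succ, AlgHom.mul_apply, AlgEquiv.mul_apply]; exact ih (φ y)

omit [IsFractionRing R L] in
include hw in
/-- **(ii) graded additive Hilbert 90 on `𝒪_L`.** With `k = R/𝔪` finite of order `qⁿ` and `φ`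
inducing `x ↦ x^q` on `k` (and all of `Aut(L/F)` preserving `R`): for `a ∈ 𝒪_L` with
`|Σ_{j<n} φʲ a| < 1` there is `b ∈ 𝒪_L` with `|φ b − b − a| < 1` — the residue of `a` has trace
zero to `𝔽_q`, hence is `b̄^q − b̄` (part 7, `exists_frob_sub_eq_of_sum_pow_eq_zero`).
[cite: SerreLocalFields1979, X §1 Prop. 1 and V §2] -/
theorem exists_val_frob_sub_sub_lt_one [Finite (IsLocalRing.ResidueField R)]
    (hR : ∀ (τ : L ≃ₐ[F] L) (x : L), x ∈ Set.range (algebraMap R L) →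
      τ x ∈ Set.range (algebraMap R L))
    (φ : L ≃ₐ[F] L) {q n : ℕ} (hcard : Nat.card (IsLocalRing.ResidueField R) = q ^ n)
    (hfrob : ∀ a : R, ∃ a' : R, algebraMap R L a' = φ (algebraMap R L a) ∧
      IsLocalRing.residue R a' = IsLocalRing.residue R a ^ q)
    {a : L} (ha : w a ≤ 1) (hs : w (∑ j ∈ Finset.range n, ((φ : L →ₐ[F] L) ^ j) a) < 1) :
    ∃ b : L, w b ≤ 1 ∧ w (φ b - b - a) < 1 := by
  have hinj : Function.Injective (algebraMap R L) := hw.hom_inj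
  -- `φ` restricted to `R` and to the residue field (as in part 4)
  have hex : ∀ c : R, ∃ c' : R, algebraMap R L c' = φ (algebraMap R L c) := fun c ↦ by
    obtain ⟨c', hc'⟩ := hR φ (algebraMap R L c) ⟨c, rfl⟩
    exact ⟨c', hc'⟩
  choose f hf using hex
  let σR : R →+* R :=
    { toFun := f
      map_one' := hinj (by simp only [hf, map_one])
      map_mul' := fun a b ↦ hinj (by simp only [hf, map_mul])
      map_zero' := hinj (by simp only [hf, map_zero])
      map_add' := fun a b ↦ hinj (by simp only [hf, map_add]) }
  have hσR : ∀ c : R, algebraMap R L (σR c) = φ (algebraMap R L c) := hf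
  haveI : IsLocalHom σR := by
    refine ⟨fun c hc ↦ ?_⟩
    obtain ⟨b, hb⟩ := isUnit_iff_exists_inv.mp hc
    obtain ⟨b', hb'⟩ := hR φ⁻¹ (algebraMap R L b) ⟨b, rfl⟩
    refine isUnit_iff_exists_inv.mpr ⟨b', hinj ?_⟩
    rw [map_mul, map_one, hb']
    have h1 : φ (algebraMap R L c) * algebraMap R L b = 1 := by
      rw [← hσR, ← map_mul, hb, map_one]
    have h2 := congrArg (φ⁻¹ : L ≃ₐ[F] L) h1
    rw [map_mul, map_one] at h2
    rwa [show (φ⁻¹ : L ≃ₐ[F] L) (φ (algebraMap R L c)) = algebraMap R L c from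
      φ.symm_apply_apply _] at h2
  set σk : IsLocalRing.ResidueField R →+* IsLocalRing.ResidueField R :=
    IsLocalRing.ResidueField.map σR with hσkdef
  have hσk' : ∀ c : R, σk (IsLocalRing.residue R c) = IsLocalRing.residue R (σR c) := fun c ↦
    IsLocalRing.ResidueField.map_residue σR c
  have hσk : ∀ x : IsLocalRing.ResidueField R, σk x = x ^ q := by
    intro x
    obtain ⟨c, rfl⟩ := IsLocalRing.residue_surjective x
    obtain ⟨c', hc', hres⟩ := hfrob c
    rw [hσk', show σR c = c' from hinj (by rw [hσR, hc']), hres]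
  -- iterates
  have hiterL : ∀ (j : ℕ) (c : R), ((φ : L →ₐ[F] L) ^ j) (algebraMap R L c) =
      algebraMap R L ((⇑σR)^[j] c) := by
    intro j
    induction j with
    | zero => intro c; simp
    | succ j ih =>
      intro c
      rw [pow_succ, AlgHom.mul_apply, Function.iterate_succ_apply, ← ih (σR c), hσR]
      rfl
  have hiterk : ∀ (j : ℕ) (c : R), IsLocalRing.residue R ((⇑σR)^[j] c) =
      (⇑σk)^[j] (IsLocalRing.residue R c) := by
    intro j
    induction j with
    | zero => intro c; simp
    | succ j ih => intro c; rw [Function.iterate_succ_apply, Function.iterate_succ_apply, ih, hσk']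
  -- the residue of `a` has trace zero
  obtain ⟨r, rfl⟩ := hw.exists_of_le_one ha
  have hsum : ∑ j ∈ Finset.range n, ((φ : L →ₐ[F] L) ^ j) (algebraMap R L r) =
      algebraMap R L (∑ j ∈ Finset.range n, (⇑σR)^[j] r) := by
    rw [map_sum]
    exact Finset.sum_congr rfl fun j _ ↦ hiterL j r
  rw [hsum, v_algebraMap_lt_one_iff hw, map_sum] at hs
  simp only [hiterk] at hs
  obtain ⟨bbar, hb⟩ := exists_frob_sub_eq_of_sum_pow_eq_zero σk hcard hσk _ hs
  obtain ⟨b, rfl⟩ := IsLocalRing.residue_surjective bbar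
  refine ⟨algebraMap R L b, hw.map_le_one b, ?_⟩
  rw [← hσR, ← map_sub, ← map_sub, v_algebraMap_lt_one_iff hw, map_sub, map_sub, ← hσk', hb,
    sub_self]

/-! ### §2 The formal-group half `h1ker` over a complete unramified layer -/

include hw in
/-- **The formal-group half of (α): `H¹(⟨φ⟩, E₁(L)) = 0` in cyclic form** (the stub `h1ker` of
`hα_of_cyclic_of_halves` HOLDS on `E₁(L)` = the points reducing to `O`). Hypotheses: `R` complete
(`IsAdicComplete 𝔪 R`) with finite residue field of order `qⁿ`; `φ ∈ Aut(L/F)` an isometry of `w`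
with `φⁿ = 1` inducing `x ↦ x^q` on the residue field; all of `Aut(L/F)` preserving `R`; a
uniformiser `ϖ` of `R` which comes from `F` (`L/F` unramified); `X ⊗ L` elliptic with an `R`-model.
Conclusion: every `m ∈ E₁(L)` with `Σ_{j<n} φʲ m = O` is `φ P − P` for some `P ∈ E₁(L)`. This is
the tree's abstract successive approximation `FormalGroupChart.exists_map_sub_eq_of_sum_eq_zero`
on the layer `L` itself, with its four inputs supplied by parts 6–7. Milne, *ADT* I.3.8 (proof,
identity component); Serre, *Local Fields* V §2, XIII §1.
[cite: MilneADT2006, Ch. I Prop. 3.8 (proof)] [cite: SerreLocalFields1979, V §2, XIII §1] -/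
theorem h1ker_of_complete [IsAdicComplete (IsLocalRing.maximalIdeal R) R]
    [Finite (IsLocalRing.ResidueField R)] [(X.baseChange L).IsElliptic]
    (W₀ : WeierstrassCurve R) (hX : X.baseChange L = W₀.baseChange L)
    (hR : ∀ (τ : L ≃ₐ[F] L) (x : L), x ∈ Set.range (algebraMap R L) →
      τ x ∈ Set.range (algebraMap R L))
    (φ : L ≃ₐ[F] L) (hφw : ∀ x, w (φ x) = w x) {q n : ℕ} (hn : φ ^ n = 1)
    (hcard : Nat.card (IsLocalRing.ResidueField R) = q ^ n)
    (hfrob : ∀ a : R, ∃ a' : R, algebraMap R L a' = φ (algebraMap R L a) ∧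
      IsLocalRing.residue R a' = IsLocalRing.residue R a ^ q)
    {ϖ : R} (hϖ : Irreducible ϖ) {π : F} (hπ : algebraMap F L π = algebraMap R L ϖ) :
    ∀ m ∈ {Q : (X.baseChange L).toAffine.Point | ∀ (x y : L)
        (h : (X.baseChange L).toAffine.Nonsingular x y), Q = .some x y h →
          x ∉ Set.range (algebraMap R L)},
      ∑ j ∈ Finset.range n, (φ ^ j) • m = 0 →
        ∃ P ∈ {Q : (X.baseChange L).toAffine.Point | ∀ (x y : L)
          (h : (X.baseChange L).toAffine.Nonsingular x y), Q = .some x y h →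
            x ∉ Set.range (algebraMap R L)}, φ • P - P = m := by
  intro m hm hs
  haveI hV : (X.baseChange L).IsIntegral w.integer :=
    isIntegral_integer_of_baseChange_eq X L R w hw W₀ hX
  -- the constants
  have hϖ1 : w (algebraMap R L ϖ) < 1 :=
    lt_of_le_of_ne (hw.map_le_one ϖ) (by
      rw [Ne, ← hw.isUnit_iff_valuation_eq_one]; exact hϖ.not_isUnit)
  have hϖ0 : 0 < w (algebraMap R L ϖ) :=
    (Valuation.pos_iff _).mpr (by rw [Ne, map_eq_zero_iff _ hw.hom_inj]; exact hϖ.ne_zero)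
  have hπρ : w (algebraMap F L π) = w (algebraMap R L ϖ) := by rw [hπ]
  -- membership of `m` in the chart kernel and in the layer `⊤`
  have hker_iff : ∀ Q : (X.baseChange L).toAffine.Point,
      Q ∈ kernel w (X.baseChange L) ↔ ∀ (x y : L) (h : (X.baseChange L).toAffine.Nonsingular x y),
        Q = .some x y h → x ∉ Set.range (algebraMap R L) := by
    intro Q
    rcases Q with _ | ⟨x, y, h⟩
    · exact ⟨fun _ x y h he ↦ (WeierstrassCurve.Affine.Point.some_ne_zero _ he.symm).elim,
        fun _ ↦ (kernel w _).zero_mem⟩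
    · rw [some_mem_kernel_iff, ← not_mem_range_iff hw]
      refine ⟨fun hx x' y' h' he ↦ ?_, fun H ↦ H x y h rfl⟩
      simp only [WeierstrassCurve.Affine.Point.some.injEq] at he
      rw [← he.1]; exact hx
  have hmK : m ∈ kernel w (X.baseChange L) := (hker_iff m).mpr hm
  -- powers of `φ` on points
  have hcoe : ∀ j : ℕ, ((φ ^ j : L ≃ₐ[F] L) : L →ₐ[F] L) = (φ : L →ₐ[F] L) ^ j := fun j ↦
    AlgHom.ext fun y ↦ (algHom_pow_apply L φ j y).symm
  have hms : ∑ j ∈ Finset.range n,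
      WeierstrassCurve.Affine.Point.map ((φ : L →ₐ[F] L) ^ j) m = 0 := by
    rw [← hs]
    exact Finset.sum_congr rfl fun j _ ↦ by rw [WeierstrassCurve.smul_def, hcoe]
  obtain ⟨P, hPK, -, hP⟩ := exists_map_sub_eq_of_sum_eq_zero (E := F) (X := X)
    (Kn := (⊤ : IntermediateField F L)) (F := (φ : L →ₐ[F] L)) (n := n)
    (fun x ↦ hφw x) (fun _ ↦ IntermediateField.mem_top)
    (fun x ↦ by rw [algHom_pow_apply, hn, AlgEquiv.one_apply]) hπρ hϖ0 hϖ1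
    (fun x hx ↦ val_le_val_uniformizer_of_lt_one L R w hw hϖ hx)
    (fun a ha hsa ↦ by
      obtain ⟨b, hb1, hb⟩ :=
        exists_val_frob_sub_sub_lt_one L R w hw hR φ hcard hfrob ha hsa
      exact ⟨⟨b, IntermediateField.mem_top⟩, hb1, hb⟩)
    (fun z hz ↦ by
      obtain ⟨P, hP, hPz⟩ := exists_mem_kernel_zCoord_eq X L R w hw hz
      exact ⟨P, hP, map_val_top_surjective X L P, hPz⟩)
    (fun x hx ↦ by
      obtain ⟨y, hy⟩ := exists_limit_of_forall_val_sub_le_pow L R w hw hϖ (fun r ↦ (x r : L)) hx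
      exact ⟨⟨y, IntermediateField.mem_top⟩, hy⟩)
    hmK (map_val_top_surjective X L m) hms
  refine ⟨P, (hker_iff P).mp hPK, ?_⟩
  rw [WeierstrassCurve.smul_def]
  exact hP

/-! ### §3 (α) PROVED at multiplicative places with a presented node; the end form -/

include hw in
/-- **(α) of `JetchevKummerAtP` as a theorem at a place with a presented node over a complete
unramified layer.** Under the hypotheses of `h1ker_of_complete` and the node presentation
`W₀ mod 𝔪 = singularModel x₀ y₀ α₁ α₂`, `α₁ ≠ α₂` (part 5), with `Gal(L/F) = ⟨φ⟩`: every
`Q ∈ E(L)` with all `σ Q − Q ∈ E₀(L)` is congruent modulo `E₀(L)` to a `Gal(L/F)`-fixed point —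
`H¹(Gal(L_w/K_v), E₀(L_w)) = 0` in the form consumed by p1 (Milne *ADT* I.3.8 for `𝒜°` at the
finite unramified level; Gross 1991 p. 244). No stub remains at such places.
[cite: MilneADT2006, Ch. I Prop. 3.8] [cite: SilvermanAEC2009, VII.2 Prop. 2.1, Prop. VII.2.2,
Exercise 3.5(a)] -/
theorem hα_of_node_of_complete [IsAdicComplete (IsLocalRing.maximalIdeal R) R]
    [Finite (IsLocalRing.ResidueField R)] [(X.baseChange L).IsElliptic] [(X.baseChange L).IsMinimal R]
    (W₀ : WeierstrassCurve R) (hX : X.baseChange L = W₀.baseChange L)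
    (hR : ∀ (τ : L ≃ₐ[F] L) (x : L), x ∈ Set.range (algebraMap R L) →
      τ x ∈ Set.range (algebraMap R L))
    {x₀ y₀ α₁ α₂ : IsLocalRing.ResidueField R}
    (hW : W₀.map (IsLocalRing.residue R) = singularModel x₀ y₀ α₁ α₂) (hα : α₁ ≠ α₂)
    (φ : L ≃ₐ[F] L) (hφ : ∀ σ : L ≃ₐ[F] L, σ ∈ Subgroup.zpowers φ) (hφw : ∀ x, w (φ x) = w x)
    {q n : ℕ} (hn : φ ^ n = 1) (hcard : Nat.card (IsLocalRing.ResidueField R) = q ^ n)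
    (hfrob : ∀ a : R, ∃ a' : R, algebraMap R L a' = φ (algebraMap R L a) ∧
      IsLocalRing.residue R a' = IsLocalRing.residue R a ^ q)
    {ϖ : R} (hϖ : Irreducible ϖ) {π : F} (hπ : algebraMap F L π = algebraMap R L ϖ) :
    ∀ Q : (X.baseChange L).toAffine.Point,
      (∀ σ : L ≃ₐ[F] L, σ • Q - Q ∈ (X.baseChange L).goodReductionSubgroup R) →
        ∃ Q' : (X.baseChange L).toAffine.Point, (∀ σ : L ≃ₐ[F] L, σ • Q' = Q') ∧
          Q - Q' ∈ (X.baseChange L).goodReductionSubgroup R :=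
  hα_of_h1ker_of_node X L R W₀ hX hR hW hα φ hφ hn hcard hfrob
    (h1ker_of_complete X L R w hw W₀ hX hR φ hφw hn hcard hfrob hϖ hπ)

include hw in
/-- **Jetchev's Prop. 4.1 at a bad place `v` with a presented node, modulo p1's inputs (a), (b)
and the cocycle ONLY**: `T = ι(t₀ + p^m t₁)` with `t₀ ∈ E₀(K_v)`, i.e. `T ∈ E₀(K_v) + p^m E(K_v)`,
so `δ_v(T) ∈ H¹_{Kum⁰}(K_v, E[p^m])`. (α) and `hstab` of `JetchevKummerAtP` are discharged here;
the flag `JET@p|N` is NOT (inputs (a), (b), the link (c) and Jetchev §§5–7 remain p1's / typed).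
[cite: Jetchev2008, Prop. 4.1 (p. 819)] [cite: GrossLMS1991, Prop. 6.2 (1), pp. 244–245]
[cite: MilneADT2006, Ch. I Prop. 3.8] -/
theorem exists_baseChange_eq_add_pow_smul_of_node_of_complete [IsGalois F L]
    [IsAdicComplete (IsLocalRing.maximalIdeal R) R] [Finite (IsLocalRing.ResidueField R)]
    [(X.baseChange L).IsElliptic] [(X.baseChange L).IsMinimal R]
    (R₀ : Type*) [CommRing R₀] [IsDomain R₀] [IsDiscreteValuationRing R₀] [Algebra R₀ F]
    [IsFractionRing R₀ F] [Algebra R₀ R] [Algebra R₀ L] [IsScalarTower R₀ R L]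
    [IsScalarTower R₀ F L] [IsLocalHom (algebraMap R₀ R)] [(X.baseChange F).IsMinimal R₀]
    (W₀ : WeierstrassCurve R) (hX : X.baseChange L = W₀.baseChange L)
    (hR : ∀ (τ : L ≃ₐ[F] L) (x : L), x ∈ Set.range (algebraMap R L) →
      τ x ∈ Set.range (algebraMap R L))
    {x₀ y₀ α₁ α₂ : IsLocalRing.ResidueField R}
    (hW : W₀.map (IsLocalRing.residue R) = singularModel x₀ y₀ α₁ α₂) (hα : α₁ ≠ α₂)
    (φ : L ≃ₐ[F] L) (hφ : ∀ σ : L ≃ₐ[F] L, σ ∈ Subgroup.zpowers φ) (hφw : ∀ x, w (φ x) = w x)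
    {q n : ℕ} (hn : φ ^ n = 1) (hcard : Nat.card (IsLocalRing.ResidueField R) = q ^ n)
    (hfrob : ∀ a : R, ∃ a' : R, algebraMap R L a' = φ (algebraMap R L a) ∧
      IsLocalRing.residue R a' = IsLocalRing.residue R a ^ q)
    {ϖ : R} (hϖ : Irreducible ϖ) {π : F} (hπ : algebraMap F L π = algebraMap R L ϖ)
    {p m n' : ℕ} (hcop : Nat.Coprime n' (p ^ m)) {U P T : (X.baseChange L).toAffine.Point}
    {Rσ : (L ≃ₐ[F] L) → (X.baseChange L).toAffine.Point}
    (hT : ∀ σ : L ≃ₐ[F] L, σ • T = T)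
    (hP : (n' : ℤ) • P ∈ (X.baseChange L).goodReductionSubgroup R)
    (hRσ : ∀ σ : L ≃ₐ[F] L, (n' : ℤ) • Rσ σ ∈ (X.baseChange L).goodReductionSubgroup R)
    (hU : ∀ σ : L ≃ₐ[F] L, σ • U - U = Rσ σ) (hpU : ((p ^ m : ℕ) : ℤ) • U = P - T) :
    ∃ t₀ t₁ : (X.baseChange F).toAffine.Point,
      t₀ ∈ (X.baseChange F).goodReductionSubgroup R₀ ∧
      T = Affine.Point.baseChange (W' := X.toAffine) F L (t₀ + ((p ^ m : ℕ) : ℤ) • t₁) :=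
  exists_baseChange_eq_add_pow_smul X L R₀ R
    (fun σ _ hQ ↦ smul_mem_goodReductionSubgroup X L R hR σ hQ)
    (hα_of_node_of_complete X L R w hw W₀ hX hR hW hα φ hφ hφw hn hcard hfrob hϖ hπ)
    hcop hT hP hRσ hU hpU

end Summit.BirchSwinnertonDyer.Rank1Residual.X11b.Three.JetchevKummer

end
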